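import Summits.HodgeConjecture.HodgeConjecture.Theorems.F0P6aSpecOrgansT
import Literature.AlgebraicGeometry.AbelianSchemes.LevelStructureCoprimeChar
import HarnessLib
import HarnessLib.Audit.LibrarySuggestionsDenyListCruxes

/-!
# `F0P6aStubFROBQuotWD` — ★ RE-HOME of the crux workfile `Lines/F0_P6a_StubFROBQuotWD.lean` (tree sha16 d650a8dd3d22567b, 370 l., 4 declaration commands, code-`sorry`-free)

This `Theorems/` module is the TREE BYTES of that workfile with the NAMESPACE KEPT, so every fully-qualified name is UNCHANGED; only this module docstring is re-headed,
the `Lines` imports are switched to their ★ re-homed twins — `Lines.F0_P6a_SpecOrgansT` → ★ `Theorems.F0P6aSpecOrgansT` — and the audit carrier `LibrarySuggestionsDenyListCruxes` is CARRIED on this root part (bare import, LEAD «M-142d» (1) rule «P-κ»; parts 2…n inherit it transitively)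
Why a re-home: a `Theorems/` file cannot import a `Lines/` workfile (F0P6-ref1 o-6), and closing stmt-HodgeConjecture-24832 `--as proved --by <Theorems decl>` at rung 0 needs the
sorry-free `Lines` chain behind the gate (RE-HOME TABLE v1.7, LA7-plan (g7); PLAN «L3 cone RE-HOME» v1, LA3-plan (g5); LEAD F0P6-plan (g5) «M-140» (1)∕(4), 2026-09-02).
One part (≤ 400 l.); this is the module the `Lines/` shim and consumers import.
After the chain is ★ the `Lines` workfile becomes a one-import SHIM of `F0P6aStubFROBQuotWD` (a `Lines/` write, batched per cone on the LEAD՚s word), so no environment holds two copies (NO-CROSS-IMPORT).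
It asserts nothing beyond what the workfile already proves.  HC_CM is proved only modulo the 7 printed citations (2 remaining: hLiu418 = stmt-HodgeConjecture-24832, h413 = stmt-HodgeConjecture-24833) until rung 0 closes; a re-home is count-neutral.

## Original module docstring (verbatim)
# F0 · P6a — `stub_FROB` road, W6: THE `stub_QUOTWD` ADAPTER — quotient reduction is well defined on the geometric specialisation, from L2՚s (ρ1𝒞) head BY TYPE (leaflet ED. 1 cand v1, HOME-first; LA3-p01 (g3))

ED. 1 — QUOTWD adapter; L2 debt = `exists_quotLegReduction` by type.  (b) THE WRITABLE BYTE-SET: imports = served `…Lines.F0_P6a_SpecOrgansT` (PART B: §Q by name) + ★ `LevelStructureCoprimeChar` + HarnessLib; NO by-copy block.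

`crux_decl: Summit.HodgeConjecture.HodgeConjecture.Theses.HCCMUnconditional.HLiu418`.  Cell `hodgecm-mathlib` (D-0151), «GO 500» half A line L3 (socket `stub_FROB` of the
D-line `Lines/F0_P6a_DatumOfInputs.lean` ED. 1 :554; L3 closer leaf `Lines/F0_P6a_StubFROB.lean` ED. 3 4f35c0d6, whose LAST socket after ⑧∕⑨ (W5b `…StubFROBRoofGeoWiring` ∕ leaf
ED. 4) is `stub_QUOTWD` :295 — «quotient reduction is well defined on the geometric specialisation»: `∀ y (L L′ : LineOf I y), spGeoOf I 𝔡 y L = spGeoOf I 𝔡 y L′ →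
red₀ (quotΩ y L) = red₀ (quotΩ y L′)`).  Dealer LA3-plan (g2) DEAL 43 (W6-PROBE, 11:21:39Z; rehearsal `F0/P6/L3/LA3-p01/g3/QuotWDAdapter.rehearsal.v1.LA3-p01g3.lean` 516712c2
GREEN + TRIO ×3, leaf ED. 5 certificate by copy a22959a8: sorries = {placeholder, `stub_ROOFGEO`}) → ADOPTED AS THE W6 DESIGN OF RECORD 11:51:13Z → DEAL 46: THIS leaflet, OWN
namespace `Summit.HodgeConjecture.HodgeConjecture.Cruxes.HLiu418.F0P6aStubFROBQuotWD` (the leaf never shadows its names), importers 0 until leaf ED. 5, kick ALONE.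

CONTENT (Letters frame of the D-line; every declaration ≤ 400 000 heartbeats; no `instance` ∕ `private` ∕ notation ∕ `sorry`):
* §1 `exists₂_take₈` — generic row bookkeeping: drop the 9th conjunct under `∃ ψ (_ : IsMonHom ψ), …` (= L2 leaf՚s `exists₂_dropLast`, LA2-p04 (g3), under an L3 name; no `cases`
  against the large goal).
* §2 **(W6) `quotwd_of_quotLegReduction`** — `stub_QUOTWD`՚s binders (leaf :296–:308 position-for-position, `𝔯 ↦ _𝔯`) + ONE hypothesis `hdat : ∀ {m} E′ hE′ P Q hP hQ hQP hPQ h𝔭 y L,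
  <§Q՚s 8 `hdat` rows (FLAT-SURJ)(ACT)(LVL)(SIM)(K2-gen)(RK)(KILL)(DOCK) VERBATIM>` ⟹ `stub_QUOTWD`՚s conclusion (leaf :309–:310 token for token).  PROOF = the W6 skeleton of
  record (= L2 leaf ED. 4 `stub_SPEC_of_heads`՚s `hWQ′` block, LA2-p04 (g3)): Serre letters for `𝔭_w` with scalar EXACTLY `p` WITH the cover package `(𝔠 := {Q₀ₖ}, hQ𝔠, h𝔠)` ⇐ ★
  `Literature.NumberTheory.NumberFields.SerrePresentation.exists_serrePresentation_of_ideal_of_natCast_mem w.asIdeal w.ne_bot (N := I.pChar) I.hpChar.2` (its last two conjuncts);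
  (RKG) `hrkG := hrkG_of_dock I 𝔡` (SpecOrgans PART A ED. 2 §G :932, token for token under `∀ x̄`); `hunr := I.hunr`; `hpN :=` ★ `I.lvl.coprime_of_charP (spPt 𝓜 w (red₀ y)) I.relDim _ I.pChar`
  (p850254; `0 < g` from `I.hg`); then §Q՚s HEAD `red₀Of_quotΩ_eq_of_quotLegReduction₀` (LA6-p01 (g3)) at `y′ := y`, `h := rfl`, `hsp :=` the socket՚s hypothesis.
* §3 **(W6′) `quotwd_of_quotLegReduction₉`** — the same on the FULL 9-row (ρ1𝒞) text (L2 socket `stub_RHO1`, LA2-p04 (g3) leaf ED. 4 cand v4 :1120–:1169 VERBATIM, (IMG) SHAPE (a) LAST)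
  := (W6) ∘ `exists₂_take₈`.
* §4 **(W6″) `quotwd_of_exists_quotLegReduction`** — the same with `hρ1 :` the FULL Π-type of the (ρ1𝒞) head as L2՚s `stub_SPEC_of_heads` binds it (v4 :757–:820 VERBATIM:
  `∀ 𝔡 quotΩ translΩ hhecke hroof hroof₂ hunit hKc {m} E′ hE′ P Q hP hQ hQP hPQ h𝔭 y L, <9 rows>` = the TYPE of `(exists_quotLegReduction I)`) := (W6′) at the socket՚s own
  `𝔡 quotΩ translΩ _hhecke _hroof _hroof₂ _hunit _hKc`.  ⇒ **L2 DEBT OF `stub_QUOTWD` = EXACTLY ONE NAME BY TYPE: `exists_quotLegReduction I`** (producer `Lines/F0_P6a_StubRHO1.lean`,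
  LA1-p02 (g3)); `hrkG` ∕ the `𝔠`-pack ∕ `hunr` ∕ `hpN` are NOT debts.

LEAF ED. 5 ONE-LINER (LA3-plan (g2), after ⑨ and `StubRHO1` BUILT; + `import …Lines.F0_P6a_StubFROBQuotWD`, `import …Lines.F0_P6a_StubRHO1`, and `set_option linter.unusedSectionVars false in`
before `stub_QUOTWD`՚s docstring as ED. 2 did for `stub_COV0`):
  `stub_QUOTWD I 𝔡 quotΩ translΩ _hhecke _hroof _hroof₂ 𝔯 _hunit _hKc _hdisj :=`
  `  Summit.HodgeConjecture.HodgeConjecture.Cruxes.HLiu418.F0P6aStubFROBQuotWD.quotwd_of_exists_quotLegReduction I 𝔡 quotΩ translΩ _hhecke _hroof _hroof₂ 𝔯 _hunit _hKc _hdisj`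
  `    (Summit.HodgeConjecture.HodgeConjecture.Cruxes.HLiu418.F0P6aStubRHO1.exists_quotLegReduction I)`   ⇒ leaf 0 sorry.
HOME-only candidate: NO `crux write` by an L-seat; LA3-plan (g2) writes, kick ALONE.  HC_CM is proved only modulo the 7 printed citations (2 remaining: hLiu418 = stmt-HodgeConjecture-24832,
h413 = stmt-HodgeConjecture-24833) until rung 0 closes; count-neutral.
[cite: Liu2021, Prop. D.8 (2)–(3) p. 135, p. 137] [cite: SerreTate1968, §1 Lemma 2] [cite: Conrad2004GrossZagier, §7 (Thm. 7.5)] [cite: MumfordFogartyKirwan1994, Ch. 7 §3 Thm. 7.9 (p. 139)]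
-/

set_option autoImplicit false

noncomputable section

namespace Summit.HodgeConjecture.HodgeConjecture.Cruxes.HLiu418.F0P6aStubFROBQuotWD

set_option linter.dupNamespace false  -- `Summit.HodgeConjecture.HodgeConjecture.…` BY DESIGN (D-0017)

open CategoryTheory CategoryTheory.Limits NumberField IsDedekindDomain MulAction AlgebraicGeometry
open scoped Matrix Polynomial Pointwise MonoidalCategory
open Literature.NumberTheory.GaloisRepresentations
open Literature.NumberTheory.Automorphic Literature.NumberTheory.Automorphic.UnitaryGroup
open Literature.AlgebraicGeometry.ShimuraVarieties.UnitaryCanonicalModel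
open Literature.NumberTheory.Automorphic.Liu2021.AppendixC
open Literature.AlgebraicGeometry.Motives (AlgPoints IntegralModel SchemeOver thickening thickeningGalAction thickeningLift specOver)
open Literature.NumberTheory.DiophantineGeometry (geomResidueField specialFibreFunctor specResidueField)
open Literature.AlgebraicGeometry.RelativeSpec (ActionOver)
open Literature.AlgebraicGeometry.AbelianSchemes Literature.AlgebraicGeometry.AbelianSchemes.AbelianSchemeOver
open Literature.AlgebraicGeometry.GroupSchemes.AffineGroupScheme (Alg quotIncl)
open Summit.HodgeConjecture.HodgeConjecture.Cruxes.HLiu418.F0P6aModuliDatumDefs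
open Summit.HodgeConjecture.HodgeConjecture.Cruxes.HLiu418.F0P6aRGDAssembly
open Summit.HodgeConjecture.HodgeConjecture.Cruxes.HLiu418.F0P6aDatumOfInputs
open Summit.HodgeConjecture.HodgeConjecture.Cruxes.HLiu418.F0P6aQuotientFibreEngineInputs
open Summit.HodgeConjecture.HodgeConjecture.Cruxes.HLiu418.F0P6aLineSpecialisation (spGeoOf hrkG_of_dock red₀Of_quotΩ_eq_of_quotLegReduction₀)

/-! ### §1 Row bookkeeping -/

section Helpers

/-- Drop the last of nine conjuncts under a double existential whose second binder the conjuncts may depend on (row bookkeeping: the (ρ1𝒞) rows minus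
(IMG) are §Q՚s `hdat` rows; stated generically so that NO `cases` runs against the large goal — the L2 leaf՚s `exists₂_dropLast` (LA2-p04 (g3)) verbatim under an L3 name).
[cite: Liu2021, Prop. D.8 (2) p. 135] -/
theorem exists₂_take₈ {α : Sort*} {Q : α → Prop} {R₁ R₂ R₃ R₄ R₅ R₆ R₇ R₈ R₉ : ∀ x : α, Q x → Prop}
    (h : ∃ (x : α) (q : Q x), R₁ x q ∧ R₂ x q ∧ R₃ x q ∧ R₄ x q ∧ R₅ x q ∧ R₆ x q ∧ R₇ x q ∧ R₈ x q ∧ R₉ x q) :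
    ∃ (x : α) (q : Q x), R₁ x q ∧ R₂ x q ∧ R₃ x q ∧ R₄ x q ∧ R₅ x q ∧ R₆ x q ∧ R₇ x q ∧ R₈ x q := by
  obtain ⟨x, hq, h1, h2, h3, h4, h5, h6, h7, h8, -⟩ := h
  exact ⟨x, hq, h1, h2, h3, h4, h5, h6, h7, h8⟩

end Helpers

/-! ### §2–§4 The adapter heads (W6), (W6′), (W6″) -/

section QuotWDAdapter

open scoped MonObj CategoryTheory.Obj

-- the frame of the D-line՚s `Letters` section VERBATIM (the leaf՚s `Stubs` frame adds `[IsGalois ℚ F] [FiniteDimensional F Fi] [IsGalois F Fi] [Finite G]`, unused here)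
variable {F : Type} [Field F] [NumberField F] [IsCMField F] {ι₁ : F →+* ℂ}
    {Jstar : Matrix (Fin 2) (Fin 2) F}
    {K₀ : C5.OpenCompactSubgroup ↥(finAdelic ↥(maximalRealSubfield F) F (IsCMField.complexConj F) 2 Jstar)}
    {S : RecordSystemGS F Jstar ι₁ K₀} {hU7ₛ : S.HeckeTranslateDefinedOver}
    {hJ : (Jstar.map (IsCMField.complexConj F))ᵀ = Jstar} {hJu : IsUnit Jstar}
    {Fi : Type} [Field Fi] [Algebra F Fi] {Kc : C5.SmallLevel K₀} {G : Type} [Group G]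
    {𝓜 : IntegralModel (𝓞 F) F ((thickening F Fi).obj (S.M.obj Kc))}
    {w : HeightOneSpectrum (𝓞 F)} {hw : (IsCMField.complexConj F) • w ≠ w} {h𝓨 : (𝓜.localise w).IsSmoothProper 1}
    {θ : ActionOver (𝓜.localise w).total.hom ((Fi ≃ₐ[F] Fi) × G)}
    {e : Fi →ₐ[F] AlgebraicClosure (w.adicCompletion F)}

set_option maxHeartbeats 400000 in
set_option backward.isDefEq.respectTransparency false in
/-- **(W6) `quotwd_of_quotLegReduction` — THE `stub_QUOTWD` ADAPTER**: the leaf՚s socket `stub_QUOTWD` (`Lines/F0_P6a_StubFROB.lean` ED. 3 :295, binders :296–:308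
position-for-position, conclusion :309–:310 token for token) from ONE hypothesis `hdat` = §Q՚s `hdat` rows (FLAT-SURJ)(ACT)(LVL)(SIM)(K2-gen)(RK)(KILL)(DOCK) VERBATIM
(e6add853 :203–:246) under the (ρ1𝒞) Serre-letter prefix `{m} E' hE' P Q hP hQ hQP hPQ h𝔭` and `∀ y L` — the conclusion of L2՚s (ρ1𝒞) head `exists_quotLegReduction`
minus its (IMG) row.  PROOF (pure wiring, the W6 skeleton of record): Serre letters for `𝔭_w` with scalar EXACTLY `p` together with the cover package `𝔠 := {Q₀ₖ}`
(★ `exists_serrePresentation_of_ideal_of_natCast_mem` at `N := I.pChar`, `p ∈ 𝔭_w` = `I.hpChar.2`); (RKG) by PART A §G `hrkG_of_dock I 𝔡`; `hunr := I.hunr`;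
`hpN :=` ★ `I.lvl.coprime_of_charP (spPt 𝓜 w (red₀ y)) I.relDim _ I.pChar` (`0 < g` from `I.hg`; = LS ED. 3 `coprime_pChar_N_of_specialPoint`); then §Q՚s head
`red₀Of_quotΩ_eq_of_quotLegReduction₀` at `y′ := y`, `h := rfl`, `hsp :=` the socket՚s hypothesis.
[cite: Liu2021, Prop. D.8 (2)–(3) p. 135, p. 137] [cite: SerreTate1968, §1 Lemma 2] [cite: Conrad2004GrossZagier, §7 (Thm. 7.5)] -/
theorem quotwd_of_quotLegReduction (I : RGDInputsAt F ι₁ Jstar K₀ S hU7ₛ hJ hJu Fi Kc G 𝓜 w hw h𝓨 θ e) [ExpChar (geomResidueField w) I.pChar]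
    (𝔡 : ∀ xbar, DockAt I xbar)
    (quotΩ : ∀ y, LineOf I y → AlgPoints (S.M.obj Kc) (AlgebraicClosure (w.adicCompletion F)))
    (translΩ : AlgPoints (S.M.obj Kc) (AlgebraicClosure (w.adicCompletion F)) → AlgPoints (S.M.obj Kc) (AlgebraicClosure (w.adicCompletion F)))
    (_hhecke : HeckeClause I quotΩ translΩ) (_hroof : RoofLink I quotΩ) (_hroof₂ : RoofLink₂ I translΩ) (_𝔯 : DownReadings I 𝔡 quotΩ translΩ)
    (_hunit : (UnitaryGroup.isUnit_placeForm Jstar hJu w).unit ∈ glInt 2 (w.adicCompletion F))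
    (_hKc : UnitaryGroup.IsHyperspecialAt ↥(maximalRealSubfield F) F (IsCMField.complexConj F) 2 Jstar Kc.1.1
      (w.under (𝓞 ↥(maximalRealSubfield F))))
    (_hdisj : haveI : AlgebraicGeometry.IsProper (𝓜.localise w).total.hom := h𝓨.2
      ∀ (β : Fi ≃ₐ[F] Fi) (P Q : AlgPoints (S.M.obj Kc) (AlgebraicClosure (w.adicCompletion F))),
        (𝓜.localise w).geomReductionMap (thickeningLift e (S.M.obj Kc) P) =
          AlgPoints.map ((specialFibreFunctor w).map (Over.isoMk (θ.aut (β, 1)) (θ.aut_comp (β, 1))).hom :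
              (𝓜.localise w).reductionAt ⟶ (𝓜.localise w).reductionAt)
            ((𝓜.localise w).geomReductionMap (thickeningLift e (S.M.obj Kc) Q)) → β = 1)
    -- ═════ the ONE L2 debt: the (ρ1𝒞) rows minus (IMG), for every Serre presentation of `𝔭_w` with scalar `p` and every `(y, L)` (§Q՚s `hdat` rows e6add853 :203–:246 VERBATIM)
    (hdat : ∀ {m : ℕ} (E' : Matrix (Fin m) (Fin m) (𝓞 F)) (hE' : E' * E' = E') (P : Matrix (Fin m) (Fin 1) (𝓞 F)) (Q : Matrix (Fin 1) (Fin m) (𝓞 F))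
      (_ : E' * P = P) (_ : Q * E' = Q) (_ : Q * P = Matrix.scalar (Fin 1) (I.pChar : 𝓞 F))
      (_ : P * Q = Matrix.scalar (Fin m) (I.pChar : 𝓞 F) * E') (_ : Ideal.span (Set.range fun k => P k 0) = w.asIdeal)
      (y : AlgPoints (S.M.obj Kc) (AlgebraicClosure (w.adicCompletion F))) (L : LineOf I y),
      haveI := I.comm
      letI := (𝔡 (red₀Of S Kc 𝓜 w h𝓨 e y)).grp₀
      haveI := (𝔡 (red₀Of S Kc 𝓜 w h𝓨 e y)).aff₀
        ∃ (ψ : (sch₀Of 𝓜 w I.univ (red₀Of S Kc 𝓜 w h𝓨 e y)).X ⟶ (sch₀Of 𝓜 w (serreTensor I.act E' hE') (red₀Of S Kc 𝓜 w h𝓨 e (quotΩ y L))).X) (_ : IsMonHom ψ),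
          -- (FLAT-SURJ)
          (Flat ψ.left ∧ Function.Surjective ψ.left.base) ∧
          -- (ACT) `𝒪_F`-equivariance, `act₀Of` currency on both sides (`serreAction` on `𝒞`)
          (∀ a : 𝓞 F, (act₀Of 𝓜 w I.univ I.act a (red₀Of S Kc 𝓜 w h𝓨 e y)).hom.hom.hom ≫ ψ =
            ψ ≫ (act₀Of 𝓜 w (serreTensor I.act E' hE') (serreAction I.act E' hE') a (red₀Of S Kc 𝓜 w h𝓨 e (quotΩ y L))).hom.hom.hom) ∧
          -- (LVL) level points: `ψ(σᵃ(x̄)) = (σᵃ ≫ ψ_P)(x̄″)`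
          (∀ a : Fin I.g ⊕ Fin I.g → ZMod I.N,
            AlgPoints.map ψ (lvlPt₀Of 𝓜 w I.univ I.lvl (red₀Of S Kc 𝓜 w h𝓨 e y) a) =
              ((serreTensor I.act E' hE').baseChange (pullback.fst (𝓜.localise w).total.hom (specResidueField w))).restrictPt (red₀Of S Kc 𝓜 w h𝓨 e (quotΩ y L)).left
                ((serreTensor I.act E' hE').sectionBaseChange (pullback.fst (𝓜.localise w).total.hom (specResidueField w)) (I.lvl.section_ a ≫ serreTranslate I.act E' hE' P))) ∧
          -- (SIM) for EVERY downstairs dual pair of `𝒞_{x̄″}` through which the cover leg pulls back to `λ ≫ [p]`: `ψ^* λ_B̄ = λ_{x̄} ≫ [p]`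
          (∀ (DBs : (sch₀Of 𝓜 w (serreTensor I.act E' hE') (red₀Of S Kc 𝓜 w h𝓨 e (quotΩ y L))).DualPair)
            (_ : Nonempty ((Scheme.Modules.pullback (DualPair.unitHatSlice DBs)).obj DBs.P ≅ SheafOfModules.unit _))
            (lamBs : (sch₀Of 𝓜 w (serreTensor I.act E' hE') (red₀Of S Kc 𝓜 w h𝓨 e (quotΩ y L))).X ⟶ DBs.hat.X) [IsMonHom lamBs],
            (haveI := isMonHom_coverLeg (pullback.fst (𝓜.localise w).total.hom (specResidueField w)) (red₀Of S Kc 𝓜 w h𝓨 e (quotΩ y L)).left I.act E' hE' P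
             baseChangeHom (baseChangeHom (serreTranslate I.act E' hE' P) (pullback.fst (𝓜.localise w).total.hom (specResidueField w))) (red₀Of S Kc 𝓜 w h𝓨 e (quotΩ y L)).left ≫ lamBs ≫
                DualPair.dualIsogenyOver (baseChangeHom (baseChangeHom (serreTranslate I.act E' hE' P) (pullback.fst (𝓜.localise w).total.hom (specResidueField w))) (red₀Of S Kc 𝓜 w h𝓨 e (quotΩ y L)).left)
                  (dual₀Of 𝓜 w I.univ I.dual (red₀Of S Kc 𝓜 w h𝓨 e (quotΩ y L))) DBs =
              (pol₀Of 𝓜 w I.univ I.pol (red₀Of S Kc 𝓜 w h𝓨 e (quotΩ y L))).lam ≫ (dual₀Of 𝓜 w I.univ I.dual (red₀Of S Kc 𝓜 w h𝓨 e (quotΩ y L))).hat.mulN I.pChar) →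
            ψ ≫ lamBs ≫ DualPair.dualIsogenyOver ψ (dual₀Of 𝓜 w I.univ I.dual (red₀Of S Kc 𝓜 w h𝓨 e y)) DBs =
              (pol₀Of 𝓜 w I.univ I.pol (red₀Of S Kc 𝓜 w h𝓨 e y)).lam ≫ (dual₀Of 𝓜 w I.univ I.dual (red₀Of S Kc 𝓜 w h𝓨 e y)).hat.mulN I.pChar) ∧
          -- (K2-gen) every ideal bound on the kernel descends: `Ker q(Ω̄) ⊆ A_y[𝔞](Ω̄)` for the upstairs leg is recorded through `L`'s roof, so downstairs:
          (∀ 𝔞 : Ideal (𝓞 F), (∀ Pt ∈ L.1, IsIdealTorsionΩ S Kc 𝓜 w e I.univ I.act y 𝔞 Pt) →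
            (∀ Pt : (fibreΩOf S Kc 𝓜 w e I.univ y).Points (AlgebraicClosure (w.adicCompletion F)),
              (∀ r ∈ w.asIdeal * ((IsCMField.complexConj F) • w).asIdeal, (AlgPoints.map (actΩOf S Kc 𝓜 w e I.univ I.act r y).hom.hom.hom Pt :
                (fibreΩOf S Kc 𝓜 w e I.univ y).Points (AlgebraicClosure (w.adicCompletion F))) = 1) → IsIdealTorsionΩ S Kc 𝓜 w e I.univ I.act y 𝔞 Pt) →
            ∀ ⦃T : SchemeOver (geomResidueField w)⦄ (z : T ⟶ (sch₀Of 𝓜 w I.univ (red₀Of S Kc 𝓜 w h𝓨 e y)).X),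
              z ≫ ψ = 1 → ∀ r ∈ 𝔞, z ≫ (act₀Of 𝓜 w I.univ I.act r (red₀Of S Kc 𝓜 w h𝓨 e y)).hom.hom.hom = 1) ∧
          -- (RK) the rank of `Ker ψ`, BY VALUE for every closed realisation (LA2-p04 (g2) (C6′) `hrkᵢ` text)
          (∀ (K : SchemeOver (geomResidueField w)) [GrpObj K] [IsAffine K.left] [Module.Finite (geomResidueField w) (Alg K)]
            (κ : K ⟶ (sch₀Of 𝓜 w I.univ (red₀Of S Kc 𝓜 w h𝓨 e y)).X) [IsMonHom κ] [IsClosedImmersion κ.left],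
            (∀ ⦃T : SchemeOver (geomResidueField w)⦄ (t : T ⟶ (sch₀Of 𝓜 w I.univ (red₀Of S Kc 𝓜 w h𝓨 e y)).X), (∃ s : T ⟶ K, s ≫ κ = t) ↔ t ≫ ψ = 1) →
            Module.finrank (geomResidueField w) (Alg K) = I.pChar ^ I.fDeg * I.pChar ^ I.fDeg) ∧
          -- (KILL) `ψ` kills `V(spGeoOf y L) ↪ G₀(x̄) ↪ A_{x̄}`
          quotIncl (𝔡 (red₀Of S Kc 𝓜 w h𝓨 e y)).G₀ (spGeoOf I 𝔡 y L).1 ≫ (𝔡 (red₀Of S Kc 𝓜 w h𝓨 e y)).ι₀G ≫ ψ = 1 ∧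
          -- (DOCK) `Ker ψ ∩ G₀(x̄) = V(spGeoOf y L)` on all `T`-points of the dock
          ∀ ⦃T : SchemeOver (geomResidueField w)⦄ (t : T ⟶ (𝔡 (red₀Of S Kc 𝓜 w h𝓨 e y)).G₀),
            t ≫ (𝔡 (red₀Of S Kc 𝓜 w h𝓨 e y)).ι₀G ≫ ψ = 1 ↔
              ∃ s : T ⟶ specOver (geomResidueField w) (Alg (𝔡 (red₀Of S Kc 𝓜 w h𝓨 e y)).G₀ ⧸ (spGeoOf I 𝔡 y L).1),
                s ≫ quotIncl (𝔡 (red₀Of S Kc 𝓜 w h𝓨 e y)).G₀ (spGeoOf I 𝔡 y L).1 = t) :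
    ∀ y (L L' : LineOf I y), spGeoOf I 𝔡 y L = spGeoOf I 𝔡 y L' →
      red₀Of S Kc 𝓜 w h𝓨 e (quotΩ y L) = red₀Of S Kc 𝓜 w h𝓨 e (quotΩ y L') := by
  classical
  haveI := I.comm
  intro y L L' hsp
  -- Serre letters for `𝔭_w` with scalar EXACTLY `p`, WITH the cover package `𝔠 := {Q₀ₖ}` (★, last two conjuncts)
  obtain ⟨m, E', hE', P, Q, hP, hQ, hQP, hPQ, h𝔭, hQ𝔠, h𝔠⟩ :=
    Literature.NumberTheory.NumberFields.SerrePresentation.exists_serrePresentation_of_ideal_of_natCast_mem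
      w.asIdeal w.ne_bot (N := I.pChar) I.hpChar.2
  -- `p ∤ N` at the special point `red₀ y` (★ `LevelStructure.coprime_of_charP`; = LS ED. 3 `coprime_pChar_N_of_specialPoint I (red₀ y) _`, inlined; `0 < g` from `I.hg`)
  have hpN : Nat.Coprime I.pChar I.N :=
    haveI : Fact I.pChar.Prime := ⟨I.hpChar.1⟩
    haveI : CharP (geomResidueField w) I.pChar := I.charP₀
    I.lvl.coprime_of_charP (spPt 𝓜 w (red₀Of S Kc 𝓜 w h𝓨 e y)) I.relDim (by rw [I.hg]; exact Module.finrank_pos) I.pChar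
  -- §Q՚s head at `y′ := y`, `h := rfl`; (RKG) by PART A §G, `hunr := I.hunr`
  exact red₀Of_quotΩ_eq_of_quotLegReduction₀ I E' hE' P Q hP hQ hQP hPQ h𝔭 _ hQ𝔠 h𝔠 𝔡 (hrkG_of_dock I 𝔡) quotΩ
    (fun y₁ L₁ => hdat E' hE' P Q hP hQ hQP hPQ h𝔭 y₁ L₁) I.hunr hpN y y L L' rfl hsp

set_option maxHeartbeats 400000 in
set_option backward.isDefEq.respectTransparency false in
/-- **(W6′) `quotwd_of_quotLegReduction₉` — THE SAME ADAPTER ON THE FULL (ρ1𝒞) TEXT**: hypothesis `hρ1` = the 9 rows of L2՚s socket `stub_RHO1` (L2 leaf ED. 4 cand v4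
`F0/P6/L2/LA2-p04/g3/StubDOWN.leaf.ed4.cand.v4.LA2-p04g3.lean` :1120–:1169 VERBATIM, (IMG) SHAPE (a) LAST) under the Serre-letter prefix and `∀ y L`, the socket binders
`𝔡 quotΩ translΩ` being this head՚s own.  Proof: drop the (IMG) row by the generic `exists₂_take₈` (no `cases` against the large goal) and call (W6).
[cite: Liu2021, Prop. D.8 (2)–(3) p. 135, pp. 136–138] [cite: SerreTate1968, §1 Lemma 2] -/
theorem quotwd_of_quotLegReduction₉ (I : RGDInputsAt F ι₁ Jstar K₀ S hU7ₛ hJ hJu Fi Kc G 𝓜 w hw h𝓨 θ e) [ExpChar (geomResidueField w) I.pChar]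
    (𝔡 : ∀ xbar, DockAt I xbar)
    (quotΩ : ∀ y, LineOf I y → AlgPoints (S.M.obj Kc) (AlgebraicClosure (w.adicCompletion F)))
    (translΩ : AlgPoints (S.M.obj Kc) (AlgebraicClosure (w.adicCompletion F)) → AlgPoints (S.M.obj Kc) (AlgebraicClosure (w.adicCompletion F)))
    (_hhecke : HeckeClause I quotΩ translΩ) (_hroof : RoofLink I quotΩ) (_hroof₂ : RoofLink₂ I translΩ) (_𝔯 : DownReadings I 𝔡 quotΩ translΩ)
    (_hunit : (UnitaryGroup.isUnit_placeForm Jstar hJu w).unit ∈ glInt 2 (w.adicCompletion F))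
    (_hKc : UnitaryGroup.IsHyperspecialAt ↥(maximalRealSubfield F) F (IsCMField.complexConj F) 2 Jstar Kc.1.1
      (w.under (𝓞 ↥(maximalRealSubfield F))))
    (_hdisj : haveI : AlgebraicGeometry.IsProper (𝓜.localise w).total.hom := h𝓨.2
      ∀ (β : Fi ≃ₐ[F] Fi) (P Q : AlgPoints (S.M.obj Kc) (AlgebraicClosure (w.adicCompletion F))),
        (𝓜.localise w).geomReductionMap (thickeningLift e (S.M.obj Kc) P) =
          AlgPoints.map ((specialFibreFunctor w).map (Over.isoMk (θ.aut (β, 1)) (θ.aut_comp (β, 1))).hom :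
              (𝓜.localise w).reductionAt ⟶ (𝓜.localise w).reductionAt)
            ((𝓜.localise w).geomReductionMap (thickeningLift e (S.M.obj Kc) Q)) → β = 1)
    -- ═════ the (ρ1𝒞) text: 9 rows ((FLAT-SURJ)(ACT)(LVL)(SIM)(K2-gen)(RK)(KILL)(DOCK)(IMG)) for every Serre presentation of `𝔭_w` with scalar `p` and every `(y, L)`
    (hρ1 : ∀ {m : ℕ} (E' : Matrix (Fin m) (Fin m) (𝓞 F)) (hE' : E' * E' = E') (P : Matrix (Fin m) (Fin 1) (𝓞 F)) (Q : Matrix (Fin 1) (Fin m) (𝓞 F))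
      (_ : E' * P = P) (_ : Q * E' = Q) (_ : Q * P = Matrix.scalar (Fin 1) (I.pChar : 𝓞 F))
      (_ : P * Q = Matrix.scalar (Fin m) (I.pChar : 𝓞 F) * E') (_ : Ideal.span (Set.range fun k => P k 0) = w.asIdeal)
      (y : AlgPoints (S.M.obj Kc) (AlgebraicClosure (w.adicCompletion F))) (L : LineOf I y),
    haveI := I.comm
    letI := (𝔡 (red₀Of S Kc 𝓜 w h𝓨 e y)).grp₀
    haveI := (𝔡 (red₀Of S Kc 𝓜 w h𝓨 e y)).aff₀
      ∃ (ψ : (sch₀Of 𝓜 w I.univ (red₀Of S Kc 𝓜 w h𝓨 e y)).X ⟶ (sch₀Of 𝓜 w (serreTensor I.act E' hE') (red₀Of S Kc 𝓜 w h𝓨 e (quotΩ y L))).X) (_ : IsMonHom ψ),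
        -- (FLAT-SURJ)
        (Flat ψ.left ∧ Function.Surjective ψ.left.base) ∧
        -- (ACT) `𝒪_F`-equivariance, `act₀Of` currency on both sides (`serreAction` on `𝒞`)
        (∀ a : 𝓞 F, (act₀Of 𝓜 w I.univ I.act a (red₀Of S Kc 𝓜 w h𝓨 e y)).hom.hom.hom ≫ ψ =
          ψ ≫ (act₀Of 𝓜 w (serreTensor I.act E' hE') (serreAction I.act E' hE') a (red₀Of S Kc 𝓜 w h𝓨 e (quotΩ y L))).hom.hom.hom) ∧
        -- (LVL) level points: `ψ(σᵃ(x̄)) = (σᵃ ≫ ψ_P)(x̄″)`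
        (∀ a : Fin I.g ⊕ Fin I.g → ZMod I.N,
          AlgPoints.map ψ (lvlPt₀Of 𝓜 w I.univ I.lvl (red₀Of S Kc 𝓜 w h𝓨 e y) a) =
            ((serreTensor I.act E' hE').baseChange (pullback.fst (𝓜.localise w).total.hom (specResidueField w))).restrictPt (red₀Of S Kc 𝓜 w h𝓨 e (quotΩ y L)).left
              ((serreTensor I.act E' hE').sectionBaseChange (pullback.fst (𝓜.localise w).total.hom (specResidueField w)) (I.lvl.section_ a ≫ serreTranslate I.act E' hE' P))) ∧
        -- (SIM) for EVERY downstairs dual pair of `𝒞_{x̄″}` through which the cover leg pulls back to `λ ≫ [p]`: `ψ^* λ_B̄ = λ_{x̄} ≫ [p]`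
        (∀ (DBs : (sch₀Of 𝓜 w (serreTensor I.act E' hE') (red₀Of S Kc 𝓜 w h𝓨 e (quotΩ y L))).DualPair)
          (_ : Nonempty ((Scheme.Modules.pullback (DualPair.unitHatSlice DBs)).obj DBs.P ≅ SheafOfModules.unit _))
          (lamBs : (sch₀Of 𝓜 w (serreTensor I.act E' hE') (red₀Of S Kc 𝓜 w h𝓨 e (quotΩ y L))).X ⟶ DBs.hat.X) [IsMonHom lamBs],
          (haveI := isMonHom_coverLeg (pullback.fst (𝓜.localise w).total.hom (specResidueField w)) (red₀Of S Kc 𝓜 w h𝓨 e (quotΩ y L)).left I.act E' hE' P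
           baseChangeHom (baseChangeHom (serreTranslate I.act E' hE' P) (pullback.fst (𝓜.localise w).total.hom (specResidueField w))) (red₀Of S Kc 𝓜 w h𝓨 e (quotΩ y L)).left ≫ lamBs ≫
              DualPair.dualIsogenyOver (baseChangeHom (baseChangeHom (serreTranslate I.act E' hE' P) (pullback.fst (𝓜.localise w).total.hom (specResidueField w))) (red₀Of S Kc 𝓜 w h𝓨 e (quotΩ y L)).left)
                (dual₀Of 𝓜 w I.univ I.dual (red₀Of S Kc 𝓜 w h𝓨 e (quotΩ y L))) DBs =
            (pol₀Of 𝓜 w I.univ I.pol (red₀Of S Kc 𝓜 w h𝓨 e (quotΩ y L))).lam ≫ (dual₀Of 𝓜 w I.univ I.dual (red₀Of S Kc 𝓜 w h𝓨 e (quotΩ y L))).hat.mulN I.pChar) →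
          ψ ≫ lamBs ≫ DualPair.dualIsogenyOver ψ (dual₀Of 𝓜 w I.univ I.dual (red₀Of S Kc 𝓜 w h𝓨 e y)) DBs =
            (pol₀Of 𝓜 w I.univ I.pol (red₀Of S Kc 𝓜 w h𝓨 e y)).lam ≫ (dual₀Of 𝓜 w I.univ I.dual (red₀Of S Kc 𝓜 w h𝓨 e y)).hat.mulN I.pChar) ∧
        -- (K2-gen) every ideal bound on the kernel descends: `Ker q(Ω̄) ⊆ A_y[𝔞](Ω̄)` for the upstairs leg is recorded through `L`'s roof, so downstairs:
        (∀ 𝔞 : Ideal (𝓞 F), (∀ Pt ∈ L.1, IsIdealTorsionΩ S Kc 𝓜 w e I.univ I.act y 𝔞 Pt) →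
          (∀ Pt : (fibreΩOf S Kc 𝓜 w e I.univ y).Points (AlgebraicClosure (w.adicCompletion F)),
            (∀ r ∈ w.asIdeal * ((IsCMField.complexConj F) • w).asIdeal, (AlgPoints.map (actΩOf S Kc 𝓜 w e I.univ I.act r y).hom.hom.hom Pt :
              (fibreΩOf S Kc 𝓜 w e I.univ y).Points (AlgebraicClosure (w.adicCompletion F))) = 1) → IsIdealTorsionΩ S Kc 𝓜 w e I.univ I.act y 𝔞 Pt) →
          ∀ ⦃T : SchemeOver (geomResidueField w)⦄ (z : T ⟶ (sch₀Of 𝓜 w I.univ (red₀Of S Kc 𝓜 w h𝓨 e y)).X),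
            z ≫ ψ = 1 → ∀ r ∈ 𝔞, z ≫ (act₀Of 𝓜 w I.univ I.act r (red₀Of S Kc 𝓜 w h𝓨 e y)).hom.hom.hom = 1) ∧
        -- (RK) the rank of `Ker ψ`, BY VALUE for every closed realisation (LA2-p04 (g2) (C6′) `hrkᵢ` text)
        (∀ (K : SchemeOver (geomResidueField w)) [GrpObj K] [IsAffine K.left] [Module.Finite (geomResidueField w) (Alg K)]
          (κ : K ⟶ (sch₀Of 𝓜 w I.univ (red₀Of S Kc 𝓜 w h𝓨 e y)).X) [IsMonHom κ] [IsClosedImmersion κ.left],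
          (∀ ⦃T : SchemeOver (geomResidueField w)⦄ (t : T ⟶ (sch₀Of 𝓜 w I.univ (red₀Of S Kc 𝓜 w h𝓨 e y)).X), (∃ s : T ⟶ K, s ≫ κ = t) ↔ t ≫ ψ = 1) →
          Module.finrank (geomResidueField w) (Alg K) = I.pChar ^ I.fDeg * I.pChar ^ I.fDeg) ∧
        -- (KILL) `ψ` kills `V(spGeoOf y L) ↪ G₀(x̄) ↪ A_{x̄}`
        quotIncl (𝔡 (red₀Of S Kc 𝓜 w h𝓨 e y)).G₀ (spGeoOf I 𝔡 y L).1 ≫ (𝔡 (red₀Of S Kc 𝓜 w h𝓨 e y)).ι₀G ≫ ψ = 1 ∧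
        -- (DOCK) `Ker ψ ∩ G₀(x̄) = V(spGeoOf y L)` on all `T`-points of the dock
        (∀ ⦃T : SchemeOver (geomResidueField w)⦄ (t : T ⟶ (𝔡 (red₀Of S Kc 𝓜 w h𝓨 e y)).G₀),
          t ≫ (𝔡 (red₀Of S Kc 𝓜 w h𝓨 e y)).ι₀G ≫ ψ = 1 ↔
            ∃ s : T ⟶ specOver (geomResidueField w) (Alg (𝔡 (red₀Of S Kc 𝓜 w h𝓨 e y)).G₀ ⧸ (spGeoOf I 𝔡 y L).1),
              s ≫ quotIncl (𝔡 (red₀Of S Kc 𝓜 w h𝓨 e y)).G₀ (spGeoOf I 𝔡 y L).1 = t) ∧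
        -- (IMG) row, SHAPE (a) of record (LA2-plan (g2) 09:18:21Z (2)): the BACKTRACKING line `L_b` with `himg` (LA2-p03 (g3) f3424bb3 :279–:285 text at `H″ := spGeoOf I 𝔡 (quotΩ y L) L_b`)
        ∃ Lb : LineOf I (quotΩ y L), quotΩ (quotΩ y L) Lb = translΩ y ∧
          (letI := (𝔡 (red₀Of S Kc 𝓜 w h𝓨 e (quotΩ y L))).grp₀; haveI := (𝔡 (red₀Of S Kc 𝓜 w h𝓨 e (quotΩ y L))).aff₀;
            ∀ ⦃T : SchemeOver (geomResidueField w)⦄ (t : T ⟶ (𝔡 (red₀Of S Kc 𝓜 w h𝓨 e y)).G₀),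
              ∃ s : T ⟶ specOver (geomResidueField w) (Alg (𝔡 (red₀Of S Kc 𝓜 w h𝓨 e (quotΩ y L))).G₀ ⧸ (spGeoOf I 𝔡 (quotΩ y L) Lb).1),
                s ≫ quotIncl (𝔡 (red₀Of S Kc 𝓜 w h𝓨 e (quotΩ y L))).G₀ (spGeoOf I 𝔡 (quotΩ y L) Lb).1 ≫ (𝔡 (red₀Of S Kc 𝓜 w h𝓨 e (quotΩ y L))).ι₀G ≫
                    baseChangeHom (baseChangeHom (serreTranslate I.act E' hE' P) (pullback.fst (𝓜.localise w).total.hom (specResidueField w))) (red₀Of S Kc 𝓜 w h𝓨 e (quotΩ y L)).left =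
                  t ≫ (𝔡 (red₀Of S Kc 𝓜 w h𝓨 e y)).ι₀G ≫ ψ)) :
    ∀ y (L L' : LineOf I y), spGeoOf I 𝔡 y L = spGeoOf I 𝔡 y L' →
      red₀Of S Kc 𝓜 w h𝓨 e (quotΩ y L) = red₀Of S Kc 𝓜 w h𝓨 e (quotΩ y L') :=
  quotwd_of_quotLegReduction I 𝔡 quotΩ translΩ _hhecke _hroof _hroof₂ _𝔯 _hunit _hKc _hdisj
    fun E' hE' P Q hP hQ hQP hPQ h𝔭 y L => exists₂_take₈ (hρ1 E' hE' P Q hP hQ hQP hPQ h𝔭 y L)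

set_option maxHeartbeats 400000 in
set_option backward.isDefEq.respectTransparency false in
/-- **(W6″) `quotwd_of_exists_quotLegReduction` — THE LEAF ED. 5 CALL-SITE SHAPE**: hypothesis `hρ1` = the FULL Π-type of the (ρ1𝒞) head as L2՚s `stub_SPEC_of_heads` binds it
(L2 leaf ED. 4 cand v4 :757–:820 VERBATIM: `∀ 𝔡 quotΩ translΩ hhecke hroof hroof₂ hunit hKc {m} E' hE' P Q hP hQ hQP hPQ h𝔭 y L, <9 rows>` — the TYPE of
`(exists_quotLegReduction I)` ∕ of L2՚s socket `(stub_RHO1 I)`), so the L3 leaf ED. 5 pays its socket by the SAME token L2՚s leaf uses: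
`stub_QUOTWD I 𝔡 quotΩ translΩ _hhecke _hroof _hroof₂ 𝔯 _hunit _hKc _hdisj := quotwd_of_exists_quotLegReduction I 𝔡 quotΩ translΩ _hhecke _hroof _hroof₂ 𝔯 _hunit _hKc _hdisj (exists_quotLegReduction I)`.
Proof: instantiate `hρ1` at the socket՚s own `𝔡 quotΩ translΩ _hhecke _hroof _hroof₂ _hunit _hKc` and call (W6′). [cite: Liu2021, Prop. D.8 (2)–(3) p. 135, pp. 136–138] -/
theorem quotwd_of_exists_quotLegReduction (I : RGDInputsAt F ι₁ Jstar K₀ S hU7ₛ hJ hJu Fi Kc G 𝓜 w hw h𝓨 θ e) [ExpChar (geomResidueField w) I.pChar]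
    (𝔡 : ∀ xbar, DockAt I xbar)
    (quotΩ : ∀ y, LineOf I y → AlgPoints (S.M.obj Kc) (AlgebraicClosure (w.adicCompletion F)))
    (translΩ : AlgPoints (S.M.obj Kc) (AlgebraicClosure (w.adicCompletion F)) → AlgPoints (S.M.obj Kc) (AlgebraicClosure (w.adicCompletion F)))
    (_hhecke : HeckeClause I quotΩ translΩ) (_hroof : RoofLink I quotΩ) (_hroof₂ : RoofLink₂ I translΩ) (_𝔯 : DownReadings I 𝔡 quotΩ translΩ)
    (_hunit : (UnitaryGroup.isUnit_placeForm Jstar hJu w).unit ∈ glInt 2 (w.adicCompletion F))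
    (_hKc : UnitaryGroup.IsHyperspecialAt ↥(maximalRealSubfield F) F (IsCMField.complexConj F) 2 Jstar Kc.1.1
      (w.under (𝓞 ↥(maximalRealSubfield F))))
    (_hdisj : haveI : AlgebraicGeometry.IsProper (𝓜.localise w).total.hom := h𝓨.2
      ∀ (β : Fi ≃ₐ[F] Fi) (P Q : AlgPoints (S.M.obj Kc) (AlgebraicClosure (w.adicCompletion F))),
        (𝓜.localise w).geomReductionMap (thickeningLift e (S.M.obj Kc) P) =
          AlgPoints.map ((specialFibreFunctor w).map (Over.isoMk (θ.aut (β, 1)) (θ.aut_comp (β, 1))).hom :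
              (𝓜.localise w).reductionAt ⟶ (𝓜.localise w).reductionAt)
            ((𝓜.localise w).geomReductionMap (thickeningLift e (S.M.obj Kc) Q)) → β = 1)
    -- ═════ the (ρ1𝒞) head BY TYPE (L2 `stub_SPEC_of_heads` binder `hρ1`, v4 :757–:820 VERBATIM)
    (hρ1 : ∀ (𝔡 : ∀ xbar, DockAt I xbar)
      -- SOCKET ORDER OF RECORD (LA2-plan (g2) 09:29:54Z (1)): `𝔡 quotΩ translΩ hhecke hroof hroof₂ hunit hKc`, THEN the Serre letters, THEN `(y) (L)`; no `hunr`∕`hpN` head binders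
      (quotΩ : ∀ y, LineOf I y → AlgPoints (S.M.obj Kc) (AlgebraicClosure (w.adicCompletion F)))
      (translΩ : AlgPoints (S.M.obj Kc) (AlgebraicClosure (w.adicCompletion F)) → AlgPoints (S.M.obj Kc) (AlgebraicClosure (w.adicCompletion F)))
      (hhecke : HeckeClause I quotΩ translΩ) (hroof : RoofLink I quotΩ) (hroof₂ : RoofLink₂ I translΩ)
      (hunit : (UnitaryGroup.isUnit_placeForm Jstar hJu w).unit ∈ glInt 2 (w.adicCompletion F))
      (hKc : UnitaryGroup.IsHyperspecialAt ↥(maximalRealSubfield F) F (IsCMField.complexConj F) 2 Jstar Kc.1.1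
        (w.under (𝓞 ↥(maximalRealSubfield F))))
      {m : ℕ} (E' : Matrix (Fin m) (Fin m) (𝓞 F)) (hE' : E' * E' = E') (P : Matrix (Fin m) (Fin 1) (𝓞 F)) (Q : Matrix (Fin 1) (Fin m) (𝓞 F))
      (hP : E' * P = P) (hQ : Q * E' = Q) (hQP : Q * P = Matrix.scalar (Fin 1) (I.pChar : 𝓞 F))
      (hPQ : P * Q = Matrix.scalar (Fin m) (I.pChar : 𝓞 F) * E') (h𝔭 : Ideal.span (Set.range fun k => P k 0) = w.asIdeal)
      (y : AlgPoints (S.M.obj Kc) (AlgebraicClosure (w.adicCompletion F))) (L : LineOf I y),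
      haveI := I.comm
      letI := (𝔡 (red₀Of S Kc 𝓜 w h𝓨 e y)).grp₀
      haveI := (𝔡 (red₀Of S Kc 𝓜 w h𝓨 e y)).aff₀
        ∃ (ψ : (sch₀Of 𝓜 w I.univ (red₀Of S Kc 𝓜 w h𝓨 e y)).X ⟶ (sch₀Of 𝓜 w (serreTensor I.act E' hE') (red₀Of S Kc 𝓜 w h𝓨 e (quotΩ y L))).X) (_ : IsMonHom ψ),
          -- (FLAT-SURJ)
          (Flat ψ.left ∧ Function.Surjective ψ.left.base) ∧
          -- (ACT) `𝒪_F`-equivariance, `act₀Of` currency on both sides (`serreAction` on `𝒞`)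
          (∀ a : 𝓞 F, (act₀Of 𝓜 w I.univ I.act a (red₀Of S Kc 𝓜 w h𝓨 e y)).hom.hom.hom ≫ ψ =
            ψ ≫ (act₀Of 𝓜 w (serreTensor I.act E' hE') (serreAction I.act E' hE') a (red₀Of S Kc 𝓜 w h𝓨 e (quotΩ y L))).hom.hom.hom) ∧
          -- (LVL) level points: `ψ(σᵃ(x̄)) = (σᵃ ≫ ψ_P)(x̄″)`
          (∀ a : Fin I.g ⊕ Fin I.g → ZMod I.N,
            AlgPoints.map ψ (lvlPt₀Of 𝓜 w I.univ I.lvl (red₀Of S Kc 𝓜 w h𝓨 e y) a) =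
              ((serreTensor I.act E' hE').baseChange (pullback.fst (𝓜.localise w).total.hom (specResidueField w))).restrictPt (red₀Of S Kc 𝓜 w h𝓨 e (quotΩ y L)).left
                ((serreTensor I.act E' hE').sectionBaseChange (pullback.fst (𝓜.localise w).total.hom (specResidueField w)) (I.lvl.section_ a ≫ serreTranslate I.act E' hE' P))) ∧
          -- (SIM) for EVERY downstairs dual pair of `𝒞_{x̄″}` through which the cover leg pulls back to `λ ≫ [p]`: `ψ^* λ_B̄ = λ_{x̄} ≫ [p]`
          (∀ (DBs : (sch₀Of 𝓜 w (serreTensor I.act E' hE') (red₀Of S Kc 𝓜 w h𝓨 e (quotΩ y L))).DualPair)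
            (_ : Nonempty ((Scheme.Modules.pullback (DualPair.unitHatSlice DBs)).obj DBs.P ≅ SheafOfModules.unit _))
            (lamBs : (sch₀Of 𝓜 w (serreTensor I.act E' hE') (red₀Of S Kc 𝓜 w h𝓨 e (quotΩ y L))).X ⟶ DBs.hat.X) [IsMonHom lamBs],
            (haveI := isMonHom_coverLeg (pullback.fst (𝓜.localise w).total.hom (specResidueField w)) (red₀Of S Kc 𝓜 w h𝓨 e (quotΩ y L)).left I.act E' hE' P
             baseChangeHom (baseChangeHom (serreTranslate I.act E' hE' P) (pullback.fst (𝓜.localise w).total.hom (specResidueField w))) (red₀Of S Kc 𝓜 w h𝓨 e (quotΩ y L)).left ≫ lamBs ≫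
                DualPair.dualIsogenyOver (baseChangeHom (baseChangeHom (serreTranslate I.act E' hE' P) (pullback.fst (𝓜.localise w).total.hom (specResidueField w))) (red₀Of S Kc 𝓜 w h𝓨 e (quotΩ y L)).left)
                  (dual₀Of 𝓜 w I.univ I.dual (red₀Of S Kc 𝓜 w h𝓨 e (quotΩ y L))) DBs =
              (pol₀Of 𝓜 w I.univ I.pol (red₀Of S Kc 𝓜 w h𝓨 e (quotΩ y L))).lam ≫ (dual₀Of 𝓜 w I.univ I.dual (red₀Of S Kc 𝓜 w h𝓨 e (quotΩ y L))).hat.mulN I.pChar) →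
            ψ ≫ lamBs ≫ DualPair.dualIsogenyOver ψ (dual₀Of 𝓜 w I.univ I.dual (red₀Of S Kc 𝓜 w h𝓨 e y)) DBs =
              (pol₀Of 𝓜 w I.univ I.pol (red₀Of S Kc 𝓜 w h𝓨 e y)).lam ≫ (dual₀Of 𝓜 w I.univ I.dual (red₀Of S Kc 𝓜 w h𝓨 e y)).hat.mulN I.pChar) ∧
          -- (K2-gen) every ideal bound on the kernel descends: `Ker q(Ω̄) ⊆ A_y[𝔞](Ω̄)` for the upstairs leg is recorded through `L`'s roof, so downstairs:
          (∀ 𝔞 : Ideal (𝓞 F), (∀ Pt ∈ L.1, IsIdealTorsionΩ S Kc 𝓜 w e I.univ I.act y 𝔞 Pt) →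
            (∀ Pt : (fibreΩOf S Kc 𝓜 w e I.univ y).Points (AlgebraicClosure (w.adicCompletion F)),
              (∀ r ∈ w.asIdeal * ((IsCMField.complexConj F) • w).asIdeal, (AlgPoints.map (actΩOf S Kc 𝓜 w e I.univ I.act r y).hom.hom.hom Pt :
                (fibreΩOf S Kc 𝓜 w e I.univ y).Points (AlgebraicClosure (w.adicCompletion F))) = 1) → IsIdealTorsionΩ S Kc 𝓜 w e I.univ I.act y 𝔞 Pt) →
            ∀ ⦃T : SchemeOver (geomResidueField w)⦄ (z : T ⟶ (sch₀Of 𝓜 w I.univ (red₀Of S Kc 𝓜 w h𝓨 e y)).X),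
              z ≫ ψ = 1 → ∀ r ∈ 𝔞, z ≫ (act₀Of 𝓜 w I.univ I.act r (red₀Of S Kc 𝓜 w h𝓨 e y)).hom.hom.hom = 1) ∧
          -- (RK) the rank of `Ker ψ`, BY VALUE for every closed realisation (LA2-p04 (g2) (C6′) `hrkᵢ` text)
          (∀ (K : SchemeOver (geomResidueField w)) [GrpObj K] [IsAffine K.left] [Module.Finite (geomResidueField w) (Alg K)]
            (κ : K ⟶ (sch₀Of 𝓜 w I.univ (red₀Of S Kc 𝓜 w h𝓨 e y)).X) [IsMonHom κ] [IsClosedImmersion κ.left],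
            (∀ ⦃T : SchemeOver (geomResidueField w)⦄ (t : T ⟶ (sch₀Of 𝓜 w I.univ (red₀Of S Kc 𝓜 w h𝓨 e y)).X), (∃ s : T ⟶ K, s ≫ κ = t) ↔ t ≫ ψ = 1) →
            Module.finrank (geomResidueField w) (Alg K) = I.pChar ^ I.fDeg * I.pChar ^ I.fDeg) ∧
          -- (KILL) `ψ` kills `V(spGeoOf y L) ↪ G₀(x̄) ↪ A_{x̄}`
          quotIncl (𝔡 (red₀Of S Kc 𝓜 w h𝓨 e y)).G₀ (spGeoOf I 𝔡 y L).1 ≫ (𝔡 (red₀Of S Kc 𝓜 w h𝓨 e y)).ι₀G ≫ ψ = 1 ∧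
          -- (DOCK) `Ker ψ ∩ G₀(x̄) = V(spGeoOf y L)` on all `T`-points of the dock
          (∀ ⦃T : SchemeOver (geomResidueField w)⦄ (t : T ⟶ (𝔡 (red₀Of S Kc 𝓜 w h𝓨 e y)).G₀),
            t ≫ (𝔡 (red₀Of S Kc 𝓜 w h𝓨 e y)).ι₀G ≫ ψ = 1 ↔
              ∃ s : T ⟶ specOver (geomResidueField w) (Alg (𝔡 (red₀Of S Kc 𝓜 w h𝓨 e y)).G₀ ⧸ (spGeoOf I 𝔡 y L).1),
                s ≫ quotIncl (𝔡 (red₀Of S Kc 𝓜 w h𝓨 e y)).G₀ (spGeoOf I 𝔡 y L).1 = t) ∧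
          -- (IMG) row, SHAPE (a) of record (LA2-plan (g2) 09:18:21Z (2)): the BACKTRACKING line `L_b` with `himg` (LA2-p03 (g3) f3424bb3 :279–:285 text at `H″ := spGeoOf I 𝔡 (quotΩ y L) L_b`)
          ∃ Lb : LineOf I (quotΩ y L), quotΩ (quotΩ y L) Lb = translΩ y ∧
            (letI := (𝔡 (red₀Of S Kc 𝓜 w h𝓨 e (quotΩ y L))).grp₀; haveI := (𝔡 (red₀Of S Kc 𝓜 w h𝓨 e (quotΩ y L))).aff₀;
              ∀ ⦃T : SchemeOver (geomResidueField w)⦄ (t : T ⟶ (𝔡 (red₀Of S Kc 𝓜 w h𝓨 e y)).G₀),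
                ∃ s : T ⟶ specOver (geomResidueField w) (Alg (𝔡 (red₀Of S Kc 𝓜 w h𝓨 e (quotΩ y L))).G₀ ⧸ (spGeoOf I 𝔡 (quotΩ y L) Lb).1),
                  s ≫ quotIncl (𝔡 (red₀Of S Kc 𝓜 w h𝓨 e (quotΩ y L))).G₀ (spGeoOf I 𝔡 (quotΩ y L) Lb).1 ≫ (𝔡 (red₀Of S Kc 𝓜 w h𝓨 e (quotΩ y L))).ι₀G ≫
                      baseChangeHom (baseChangeHom (serreTranslate I.act E' hE' P) (pullback.fst (𝓜.localise w).total.hom (specResidueField w))) (red₀Of S Kc 𝓜 w h𝓨 e (quotΩ y L)).left =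
                    t ≫ (𝔡 (red₀Of S Kc 𝓜 w h𝓨 e y)).ι₀G ≫ ψ)) :
    ∀ y (L L' : LineOf I y), spGeoOf I 𝔡 y L = spGeoOf I 𝔡 y L' →
      red₀Of S Kc 𝓜 w h𝓨 e (quotΩ y L) = red₀Of S Kc 𝓜 w h𝓨 e (quotΩ y L') :=
  quotwd_of_quotLegReduction₉ I 𝔡 quotΩ translΩ _hhecke _hroof _hroof₂ _𝔯 _hunit _hKc _hdisj
    (hρ1 𝔡 quotΩ translΩ _hhecke _hroof _hroof₂ _hunit _hKc)

end QuotWDAdapter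

end Summit.HodgeConjecture.HodgeConjecture.Cruxes.HLiu418.F0P6aStubFROBQuotWD

end
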